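/-
Copyright (c) 2026. All rights reserved.
Released under Apache 2.0 license as described in the file LICENSE.
-/
import Literature.AlgebraicGeometry.Pohlmann1968.AbelianCMFieldStabilizerCharacterCriterion
import Literature.NumberTheory.ComplexMultiplication.DegenerateCMTypesAbelianSurvivorClosure
import Literature.NumberTheory.ComplexMultiplication.CMTypeGaloisClassReflexDegree
import Literature.AlgebraicGeometry.ComplexMultiplication.SimpleIffPrimitiveCMType
import HarnessLib

/-!
# Abelian CM fields: the reflex degree is the order of the group generated by Kubota's survivors, and
# `B = D` on `A` iff `[K* : ℚ] = 2·(Rank(Φ) − 1)`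

SETTING.  `K` an ABELIAN CM field, `G = Gal(K/ℚ)`, `ρ = conjGal` (complex conjugation), `φ₀ : K → ℂ` a base
embedding, `Φ` a CM type of `K` read on `G` as `T = {g : σ_g = φ₀ ∘ g⁻¹ ∈ Φ}` (tree `embOf`), `Ŝ(χ) = Σ_{t ∈ T} χ(t)`
for a character `χ` of `G`, the SURVIVORS `S(Φ) = {χ : χ(ρ) = −1, Ŝ(χ) ≠ 0}` (`Rank(Φ) = 1 + #S(Φ)`, T. Kubota
[Kubota1965] §4 Lemma 2 = B. B. Gordon [Gordon1999HodgeAVSurvey] Prop. 9.4.1), `Stab(Φ) = {g : Φg = Φ}` (tree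
`twistStabilizer`) and `K* = ℚ(tr_Φ(K)) ⊂ ℂ` Shimura's reflex field (tree `traceField`; [Shimura1998] §8.3 Prop. 28,
§8.4 Example (1): `|Stab(Φ)|·[K* : ℚ] = [K : ℚ]`, tree `card_twistStabilizer_mul_finrank_traceField`).  The
group-level duality of the tree's `DegenerateCMTypesAbelianSurvivorClosure` (g40-#1: the characters trivial on
`Stab(T)` are the subgroup `⟨S⟩ ≤ Ĝ` generated by the survivors, `|⟨S⟩|·|Stab| = |G|`) and the dictionary
`Stab(Φ) = Stab(T)` (g39-#11) give, for every CM type `Φ` of `K` and every abelian variety `A` of type `(K; Φ)`: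

> **Theorem** (`finrank_traceField_eq_natCard_closure`).  **`[K* : ℚ] = |⟨S(Φ)⟩|`**: the reflex degree is the
> order of the group of characters generated by Kubota's survivors — `⟨S(Φ)⟩` is the character group of
> `Gal(K*/ℚ)` (`forall_twistStabilizer_apply_eq_one_iff_mem_closure`: `χ|_{Stab(Φ)} = 1 ⟺ χ ∈ ⟨S(Φ)⟩`).
> **Theorem** (`isSimple_iff_closure_eq_top`).  `A` is SIMPLE iff the survivors generate ALL characters of `G`.
> **Theorem** (`forall_hodgeClassSpan_eq_iff_finrank_traceField_eq`, `exists_exceptional_iff_lt_finrank_traceField`).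
> **`Bᵐ(A) ⊗ ℂ = Dᵐ(A) ⊗ ℂ` for all `m` iff `[K* : ℚ] = 2·(Rank(Φ) − 1)`; `A` carries an exceptional Hodge class iff
> `2·(Rank(Φ) − 1) < [K* : ℚ]`** (Ribet: `2·(Rank − 1) ≤ [K* : ℚ]` always, tree `cmTypeRank_le_finrank_traceField_div_two_add_one`).
> **Theorem** (`forall_hodgeClassSpan_eq_iff_forall_mem_closure`, `exists_exceptional_iff_exists_mem_closure`).
> `B = D` on `A` iff every odd character of `⟨S(Φ)⟩` is a survivor; an exceptional Hodge class on `A` iff some odd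
> character of `⟨S(Φ)⟩` is annihilated by `T` — e.g. an odd number of survivors whose product is annihilated
> (`exists_exceptional_of_sum_vanishing`, `exists_exceptional_of_add_add_vanishing`).

For PRIMITIVE `Φ` (`K* = K`, `⟨S⟩ = Ĝ`) the last criterion is Kubota–Pohlmann–White (`A` simple has a sporadic
cycle iff some odd character is annihilated by `T`, [Pohlmann1968] Thm. 1, [White1993SporadicCycles] §4 Thm. 3);
the reflex-degree form `[K* : ℚ] = 2(Rank − 1)` is the abelian-field reading, ON `A`, of the tree's primitive-core
criterion for all powers (`Pohlmann1968.forall_pow_hodgeClassSpan_eq_iff_of_minimal`, any CM field).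

* §1 `forall_twistStabilizer_apply_eq_one_iff_mem_closure`, `natCard_closure_mul_natCard_twistStabilizer_eq`,
  **`finrank_traceField_eq_natCard_closure`**, `finrank_fixedField_twistStabilizer_eq_natCard_closure`,
  `finrank_traceField_eq_finrank_fixedField_twistStabilizer`, `twistStabilizer_eq_bot_iff_closure_eq_top`,
  **`isSimple_iff_closure_eq_top`**.
* §2 **`forall_hodgeClassSpan_eq_iff_finrank_traceField_eq`**, `forall_hodgeClassSpan_eq_iff_two_mul_cmTypeRank_sub_one_eq_natCard_closure`,
  **`exists_exceptional_iff_lt_finrank_traceField`**, `finrank_traceField_eq_or_lt`,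
  **`forall_hodgeClassSpan_eq_iff_forall_mem_closure`**, **`exists_exceptional_iff_exists_mem_closure`**,
  `exists_exceptional_of_sum_vanishing`, `exists_exceptional_of_add_add_vanishing`.

HONEST SCOPE.  Dictionary + assembly of tree theorems (g39-#9, g39-#11, g40-#1, the reflex-degree file); abelian `K`
only.  The sources print Kubota's formula, the reflex bound and the stabiliser–reflex dictionary; the reflex-degree
and survivor-closure forms of the `B = D` criterion are this file's packaging, not numbered statements of the
sources.  THEOREMS ONLY: no definition, no named fact, no instance, no `sorry`.

## References

* [Kubota1965] T. Kubota, *On the field extension by complex multiplication*, Trans. AMS 118 (1965), §2, §4 Lemma 2.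
* [Pohlmann1968] H. Pohlmann, *Algebraic cycles on abelian varieties of complex multiplication type*, Ann. of Math. 88
  (1968), Thm. 1, §3.
* [White1993SporadicCycles] S. P. White, *Sporadic cycles on CM abelian varieties*, Compositio Math. 88 (1993), §4 Thm. 3.
* [Gordon1999HodgeAVSurvey] B. B. Gordon, *A survey of the Hodge conjecture for abelian varieties*, Thm. 6.4, §9.2,
  Prop. 9.4.1.
* [Shimura1998] G. Shimura, *Abelian Varieties with Complex Multiplication and Modular Functions*, §8.2 Prop. 26,
  §8.3 Prop. 28, §8.4 Example (1), §32.10.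
* [Dodson1984] B. Dodson, *The structure of Galois groups of CM-fields*, Trans. AMS 283 (1984), §1.3 Reflex Degree
  Theorem (proof and Remark).
* [Ribet1980] K. A. Ribet, *Division fields of abelian varieties with complex multiplication*, Mém. SMF 2 (1980),
  §3 (3.4).

## Provenance

Lane `lit-hodgefound` (Track 2, Layer A5), seat `lit-hodgefound-p10` generation 40, row g40-#2; neighbours cited by
name, nothing restated: `DegenerateCMTypesAbelianSurvivorClosure` (g40-#1), `AbelianCMFieldStabilizerCharacterCriterion`
(g39-#11: `mem_twistStabilizer_iff_forall_mul_mem_iff`, `natCard_twistStabilizer_eq_card_stabilizer`,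
`two_mul_card_stabilizer_mul_eq_iff_forall_hodgeClassSpan_eq`, `exists_exceptional_iff_exists_oddCharacter`),
`AbelianCMFieldStabilizerExceptionalClasses` (g39-#9), `CMTypeRankStabilizerBound` (g39-#7:
`finrank_eq_natCard_twistStabilizer_mul_finrank_fixedField`), `CMTypeGaloisClassReflexDegree`
(`card_twistStabilizer_mul_finrank_traceField`), `SimpleIffPrimitiveCMType` (`isSimple_iff_isPrimitive`),
`PrimitiveCMTypeSimple` (`isPrimitive_ringEquiv_complex_iff`), `CMTypeEquivalenceClassesCount`
(`pattern_primitive_iff_twistStabilizer_eq_bot`), `CMTypeRankCharactersNumberField` (`embOf`, `isCMTypeWith_gal`).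
-/

open scoped BigOperators NumberField IsMulCommutative Classical
open NumberField Module CategoryTheory CategoryTheory.Limits IntermediateField

namespace Literature.AlgebraicGeometry.Pohlmann1968

open scoped Literature.NumberTheory.ComplexMultiplication
open Literature.NumberTheory.ComplexMultiplication (twistStabilizer mem_twistStabilizer_iff typeRank IsCMTypeWith
  conjGal conjGal_apply traceField card_twistStabilizer_mul_finrank_traceField pattern_primitive_iff_twistStabilizer_eq_bot)
open Literature.NumberTheory.ComplexMultiplication.CyclicCMType.AbelianStabilizer
  (forall_stabilizer_apply_eq_one_iff_mem_closure natCard_closure_mul_card_stabilizer_eq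
  forall_stabilizer_eq_one_iff_closure_eq_top two_mul_card_stabilizer_mul_eq_iff_forall_mem_closure
  two_mul_card_stabilizer_mul_lt_iff_exists_mem_closure two_mul_card_stabilizer_mul_lt_of_sum_vanishing
  two_mul_card_stabilizer_mul_lt_of_add_add_vanishing)
open Literature.AlgebraicGeometry.Motives (CMType AbelianVariety)
open Literature.AlgebraicGeometry.HodgeTheory
open Literature.AlgebraicGeometry.VanGeemen1994 (hodgeClassSpan)
open Literature.Barriers.HodgeConjecture (divisorClassesSpan)
open Literature.AlgebraicGeometry.ComplexMultiplication (IsCMTypeRealisation isSimple_iff_isPrimitive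
  isPrimitive_ringEquiv_complex_iff)

variable {K : Type} [Field K] [NumberField K] [IsCMField K]
  {A : AbelianVariety ℂ} {ι : 𝓞 K →+* End A} {θ : K →+* Module.End ℂ (complexBetti A.X 1)}

/-! ## §0 The type read on the Galois group is a CM type for `ρ = conjGal` -/

section Helpers

/-- `σ_{ρg} = σ̄_g`: `conjGal` acts as complex conjugation under any embedding. [cite: Shimura1998, §18.2 Lemma (i)] -/
private theorem apply_conjGal_eq_cc_sc (φ₀ : K →+* ℂ) (x : K) :
    φ₀ ((conjGal : K ≃ₐ[ℚ] K) x) = starRingEnd ℂ (φ₀ x) := by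
  rw [conjGal_apply, IsCMField.complexEmbedding_complexConj]

variable [IsAbelianGalois ℚ K]

/-- `T = {g : σ_g ∈ Φ}` is a CM type on `G = Gal(K/ℚ)` w.r.t. `ρ = conjGal` (abelian `K`).
[cite: Kubota1965, §4 Lemma 2] [cite: Shimura1998, §18.2 Lemma (i)] -/
private theorem isCMTypeWith_filter_sc (Φ : CMType K) (φ₀ : K →+* ℂ) :
    IsCMTypeWith (conjGal : K ≃ₐ[ℚ] K)
      (↑(Finset.univ.filter fun s : K ≃ₐ[ℚ] K => embOf φ₀ s ∈ Φ.1) : Set (K ≃ₐ[ℚ] K)) := by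
  rw [Finset.coe_filter_univ]
  exact isCMTypeWith_gal (fun g h => mul_comm g h) Φ φ₀ conjGal (apply_conjGal_eq_cc_sc φ₀)

end Helpers

variable [IsAbelianGalois ℚ K]

/-! ## §1 The reflex degree is the order of the group generated by the survivors -/

section ReflexDegree

omit [IsCMField K] in
/-- **`χ|_{Stab(Φ)} = 1 ⟺ χ ∈ ⟨S(Φ)⟩`**: a character of `Gal(K/ℚ)` is trivial on the stabiliser `Stab(Φ) = Gal(K/K*)`
iff it lies in the group generated by the survivors — `⟨S(Φ)⟩` is the character group of `Gal(K*/ℚ)` (abelian `K`,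
any CM type; `ρ` any element for which `T` is a CM type is not needed: the statement is about `conjGal`).
[cite: Kubota1965, §4 Lemma 2] [cite: Dodson1984, §1.3 Reflex Degree Theorem (proof)] [cite: Shimura1998, §8.4 Example (1)] -/
theorem forall_twistStabilizer_apply_eq_one_iff_mem_closure [IsCMField K] (Φ : CMType K) (φ₀ : K →+* ℂ)
    (χ : AddChar (Additive (K ≃ₐ[ℚ] K)) ℂ) :
    (∀ g ∈ twistStabilizer Φ, χ (Additive.ofMul g) = 1) ↔
      χ ∈ AddSubgroup.closure {χ : AddChar (Additive (K ≃ₐ[ℚ] K)) ℂ |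
        χ (Additive.ofMul (conjGal : K ≃ₐ[ℚ] K)) = -1 ∧
          ∑ s ∈ (Finset.univ.filter fun s : K ≃ₐ[ℚ] K => embOf φ₀ s ∈ Φ.1), χ (Additive.ofMul s) ≠ 0} := by
  rw [← forall_stabilizer_apply_eq_one_iff_mem_closure (isCMTypeWith_filter_sc Φ φ₀) χ]
  constructor
  · intro h s hs
    exact h s ((mem_twistStabilizer_iff_forall_mul_mem_iff φ₀ Φ s).2 hs)
  · intro h g hg
    exact h g ((mem_twistStabilizer_iff_forall_mul_mem_iff φ₀ Φ g).1 hg)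

/-- **`|⟨S(Φ)⟩|·|Stab(Φ)| = [K:ℚ]`.** [cite: Dodson1984, §1.3 Reflex Degree Theorem (proof and Remark)]
[cite: Kubota1965, §4 Lemma 2] -/
theorem natCard_closure_mul_natCard_twistStabilizer_eq (Φ : CMType K) (φ₀ : K →+* ℂ) :
    Nat.card (AddSubgroup.closure {χ : AddChar (Additive (K ≃ₐ[ℚ] K)) ℂ |
        χ (Additive.ofMul (conjGal : K ≃ₐ[ℚ] K)) = -1 ∧
          ∑ s ∈ (Finset.univ.filter fun s : K ≃ₐ[ℚ] K => embOf φ₀ s ∈ Φ.1), χ (Additive.ofMul s) ≠ 0}) *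
      Nat.card (twistStabilizer Φ) = finrank ℚ K := by
  rw [natCard_twistStabilizer_eq_card_stabilizer φ₀ Φ,
    natCard_closure_mul_card_stabilizer_eq (isCMTypeWith_filter_sc Φ φ₀), ← Nat.card_eq_fintype_card,
    IsGalois.card_aut_eq_finrank]

/-- **THE REFLEX DEGREE IS THE ORDER OF THE GROUP GENERATED BY KUBOTA'S SURVIVORS: `[K* : ℚ] = |⟨S(Φ)⟩|`**
(`K* = ℚ(tr_Φ(K)) ⊂ ℂ` Shimura's reflex field; `|Stab(Φ)|·[K* : ℚ] = [K:ℚ] = |⟨S⟩|·|Stab(Φ)|`).  `K*` is the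
compositum of the cyclic subfields of `K` cut out by the odd characters `χ` with `Σ_{t ∈ T} χ(t) ≠ 0`.
[cite: Shimura1998, §8.3 Prop. 28 and §8.4 Example (1)] [cite: Dodson1984, §1.3 Reflex Degree Theorem (proof and Remark)]
[cite: Kubota1965, §4 Lemma 2] -/
theorem finrank_traceField_eq_natCard_closure (Φ : CMType K) (φ₀ : K →+* ℂ) :
    finrank ℚ (traceField Φ) =
      Nat.card (AddSubgroup.closure {χ : AddChar (Additive (K ≃ₐ[ℚ] K)) ℂ |
        χ (Additive.ofMul (conjGal : K ≃ₐ[ℚ] K)) = -1 ∧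
          ∑ s ∈ (Finset.univ.filter fun s : K ≃ₐ[ℚ] K => embOf φ₀ s ∈ Φ.1), χ (Additive.ofMul s) ≠ 0}) := by
  have h1 := card_twistStabilizer_mul_finrank_traceField (fun a b => mul_comm a b) Φ
  have h2 := natCard_closure_mul_natCard_twistStabilizer_eq Φ φ₀
  have hpos : 0 < Nat.card (twistStabilizer Φ) := Nat.card_pos
  apply Nat.eq_of_mul_eq_mul_left hpos
  rw [h1, ← h2, mul_comm]

/-- **`[K^{Stab(Φ)} : ℚ] = |⟨S(Φ)⟩|`** for the fixed field of the stabiliser (tree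
`finrank_eq_natCard_twistStabilizer_mul_finrank_fixedField`). [cite: Dodson1984, §1.3 Reflex Degree Theorem (proof)]
[cite: Kubota1965, §4 Lemma 2] -/
theorem finrank_fixedField_twistStabilizer_eq_natCard_closure (Φ : CMType K) (φ₀ : K →+* ℂ) :
    finrank ℚ (fixedField (twistStabilizer Φ)) =
      Nat.card (AddSubgroup.closure {χ : AddChar (Additive (K ≃ₐ[ℚ] K)) ℂ |
        χ (Additive.ofMul (conjGal : K ≃ₐ[ℚ] K)) = -1 ∧
          ∑ s ∈ (Finset.univ.filter fun s : K ≃ₐ[ℚ] K => embOf φ₀ s ∈ Φ.1), χ (Additive.ofMul s) ≠ 0}) := by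
  have h1 := finrank_eq_natCard_twistStabilizer_mul_finrank_fixedField Φ
  have h2 := natCard_closure_mul_natCard_twistStabilizer_eq Φ φ₀
  have hpos : 0 < Nat.card (twistStabilizer Φ) := Nat.card_pos
  apply Nat.eq_of_mul_eq_mul_left hpos
  rw [← h1, ← h2, mul_comm]

/-- **Abelian `K`: `[K* : ℚ] = [K^{Stab(Φ)} : ℚ]`** — Shimura's complex reflex field and the fixed field of the
stabiliser have the same degree (both are `|⟨S(Φ)⟩|`; indeed `K* = K^{Stab(Φ)}` inside `K ⊂ ℂ`).
[cite: Shimura1998, §8.3 Prop. 28 and §8.4 Example (1)] [cite: Dodson1984, §1.3 Reflex Degree Theorem (proof)] -/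
theorem finrank_traceField_eq_finrank_fixedField_twistStabilizer (Φ : CMType K) :
    finrank ℚ (traceField Φ) = finrank ℚ (fixedField (twistStabilizer Φ)) := by
  obtain ⟨φ₀⟩ := (inferInstance : Nonempty (K →+* ℂ))
  rw [finrank_traceField_eq_natCard_closure Φ φ₀, finrank_fixedField_twistStabilizer_eq_natCard_closure Φ φ₀]

/-- **`Stab(Φ) = 1 ⟺ ⟨S(Φ)⟩ = Ĝ`**: the type is primitive iff the survivors generate the whole character group.
[cite: Kubota1965, §2] [cite: Shimura1998, §8.2 Prop. 26 and §8.4 Example (1)] [cite: Dodson1984, §1.3 Reflex Degree Theorem] -/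
theorem twistStabilizer_eq_bot_iff_closure_eq_top (Φ : CMType K) (φ₀ : K →+* ℂ) :
    twistStabilizer Φ = ⊥ ↔
      AddSubgroup.closure {χ : AddChar (Additive (K ≃ₐ[ℚ] K)) ℂ |
        χ (Additive.ofMul (conjGal : K ≃ₐ[ℚ] K)) = -1 ∧
          ∑ s ∈ (Finset.univ.filter fun s : K ≃ₐ[ℚ] K => embOf φ₀ s ∈ Φ.1), χ (Additive.ofMul s) ≠ 0} = ⊤ := by
  rw [Subgroup.eq_bot_iff_forall, ← forall_stabilizer_eq_one_iff_closure_eq_top (isCMTypeWith_filter_sc Φ φ₀)]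
  constructor
  · intro h g hg
    exact h g ((mem_twistStabilizer_iff_forall_mul_mem_iff φ₀ Φ g).2 hg)
  · intro h g hg
    exact h g ((mem_twistStabilizer_iff_forall_mul_mem_iff φ₀ Φ g).1 hg)

/-- **`A` IS SIMPLE IFF KUBOTA'S SURVIVORS GENERATE THE WHOLE CHARACTER GROUP OF `Gal(K/ℚ)`** (abelian CM field
`K`, any CM type `Φ`, any abelian variety `A` of type `(K; Φ)`): simple ⟺ primitive (Shimura §8.2 Prop. 26) ⟺
`Stab(Φ) = 1` ⟺ `⟨S(Φ)⟩ = Ĝ`. [cite: Shimura1998, §8.2 Prop. 26 and §8.4 Example (1)] [cite: Kubota1965, §2 and §4 Lemma 2] -/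
theorem isSimple_iff_closure_eq_top (Φ : CMType K) (φ₀ : K →+* ℂ) (hA : IsCMTypeRealisation Φ A ι θ) :
    A.IsSimple ↔
      AddSubgroup.closure {χ : AddChar (Additive (K ≃ₐ[ℚ] K)) ℂ |
        χ (Additive.ofMul (conjGal : K ≃ₐ[ℚ] K)) = -1 ∧
          ∑ s ∈ (Finset.univ.filter fun s : K ≃ₐ[ℚ] K => embOf φ₀ s ∈ Φ.1), χ (Additive.ofMul s) ≠ 0} = ⊤ := by
  rw [isSimple_iff_isPrimitive hA φ₀, isPrimitive_ringEquiv_complex_iff, pattern_primitive_iff_twistStabilizer_eq_bot,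
    twistStabilizer_eq_bot_iff_closure_eq_top Φ φ₀]

end ReflexDegree

/-! ## §2 `B = D` on `A` iff `[K* : ℚ] = 2·(Rank(Φ) − 1)` iff every odd character of `⟨S(Φ)⟩` survives -/

section Hodge

/-- **`Bᵐ(A) ⊗ ℂ = Dᵐ(A) ⊗ ℂ` FOR ALL `m` IFF `[K* : ℚ] = 2·(Rank(Φ) − 1)`** (abelian CM field `K`, any CM type, any
abelian variety `A` of the type): the tree's `2·|Stab(Φ)|·(Rank(Φ) − 1) = [K:ℚ] ⟺ B = D` (g39-#9) divided by
`|Stab(Φ)|`, `[K:ℚ] = |Stab(Φ)|·[K* : ℚ]`.  Ribet's `Rank(Φ) ≤ [K* : ℚ]/2 + 1` is the inequality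
`2·(Rank − 1) ≤ [K* : ℚ]` behind it. [cite: Gordon1999HodgeAVSurvey, Thm. 6.4 and §9.2] [cite: White1993SporadicCycles, §4 Theorem 3]
[cite: Ribet1980, §3 (3.4)] [cite: Shimura1998, §8.4 Example (1) and §32.10] -/
theorem forall_hodgeClassSpan_eq_iff_finrank_traceField_eq (Φ : CMType K) (hA : IsCMTypeRealisation Φ A ι θ) :
    (∀ m : ℕ, hodgeClassSpan (finrank ℚ K / 2) A.X m = divisorClassesSpan A.X (finrank ℚ K / 2) m) ↔
      finrank ℚ (traceField Φ) = 2 * (cmTypeRank Φ - 1) := by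
  rw [← two_mul_natCard_twistStabilizer_mul_eq_iff_forall_hodgeClassSpan_eq Φ hA,
    ← card_twistStabilizer_mul_finrank_traceField (fun a b => mul_comm a b) Φ]
  have hpos : 0 < Nat.card (twistStabilizer Φ) := Nat.card_pos
  constructor
  · intro h
    apply Nat.eq_of_mul_eq_mul_left hpos
    calc Nat.card (twistStabilizer Φ) * finrank ℚ (traceField Φ)
        = 2 * Nat.card (twistStabilizer Φ) * (cmTypeRank Φ - 1) := h.symm
      _ = Nat.card (twistStabilizer Φ) * (2 * (cmTypeRank Φ - 1)) := by ring
  · intro h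
    calc 2 * Nat.card (twistStabilizer Φ) * (cmTypeRank Φ - 1)
        = Nat.card (twistStabilizer Φ) * (2 * (cmTypeRank Φ - 1)) := by ring
      _ = Nat.card (twistStabilizer Φ) * finrank ℚ (traceField Φ) := by rw [h]

/-- `B = D` on `A` iff `2·(Rank(Φ) − 1) = |⟨S(Φ)⟩|` (the survivors generate a group of order exactly
`2·(Rank(Φ) − 1)`). [cite: Kubota1965, §4 Lemma 2] [cite: Gordon1999HodgeAVSurvey, Thm. 6.4 and §9.2] -/
theorem forall_hodgeClassSpan_eq_iff_two_mul_cmTypeRank_sub_one_eq_natCard_closure (Φ : CMType K) (φ₀ : K →+* ℂ)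
    (hA : IsCMTypeRealisation Φ A ι θ) :
    (∀ m : ℕ, hodgeClassSpan (finrank ℚ K / 2) A.X m = divisorClassesSpan A.X (finrank ℚ K / 2) m) ↔
      2 * (cmTypeRank Φ - 1) =
        Nat.card (AddSubgroup.closure {χ : AddChar (Additive (K ≃ₐ[ℚ] K)) ℂ |
          χ (Additive.ofMul (conjGal : K ≃ₐ[ℚ] K)) = -1 ∧
            ∑ s ∈ (Finset.univ.filter fun s : K ≃ₐ[ℚ] K => embOf φ₀ s ∈ Φ.1), χ (Additive.ofMul s) ≠ 0}) := by
  rw [forall_hodgeClassSpan_eq_iff_finrank_traceField_eq Φ hA, finrank_traceField_eq_natCard_closure Φ φ₀, eq_comm]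

/-- **`A` CARRIES AN EXCEPTIONAL HODGE CLASS IFF `2·(Rank(Φ) − 1) < [K* : ℚ]`** (a rational `(m,m)`-class outside
`Dᵐ(A) ⊗ ℂ` for some `m`; abelian CM field, any CM type, any abelian variety of the type).
[cite: Gordon1999HodgeAVSurvey, Thm. 6.4 and §9.2] [cite: White1993SporadicCycles, §4 Theorem 3] [cite: Ribet1980, §3 (3.4)] -/
theorem exists_exceptional_iff_lt_finrank_traceField (Φ : CMType K) (hA : IsCMTypeRealisation Φ A ι θ) :
    (∃ m : ℕ, ∃ c : complexBetti A.X (2 * m), IsRationalClass c ∧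
        IsOfHodgeType (finrank ℚ K / 2) A.X (2 * m) m m c ∧ c ∉ divisorClassesSpan A.X (finrank ℚ K / 2) m) ↔
      2 * (cmTypeRank Φ - 1) < finrank ℚ (traceField Φ) := by
  rw [← two_mul_natCard_twistStabilizer_mul_lt_iff_exists_exceptional Φ hA,
    ← card_twistStabilizer_mul_finrank_traceField (fun a b => mul_comm a b) Φ,
    show 2 * Nat.card (twistStabilizer Φ) * (cmTypeRank Φ - 1) =
      Nat.card (twistStabilizer Φ) * (2 * (cmTypeRank Φ - 1)) by ring]
  have hpos : 0 < Nat.card (twistStabilizer Φ) := Nat.card_pos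
  exact ⟨fun h => Nat.lt_of_mul_lt_mul_left h, fun h => Nat.mul_lt_mul_of_pos_left h hpos⟩

/-- **THE DICHOTOMY IN REFLEX DEGREES**: either `[K* : ℚ] = 2·(Rank(Φ) − 1)` and `B = D` on `A`, or
`2·(Rank(Φ) − 1) < [K* : ℚ]` and `A` carries an exceptional Hodge class. [cite: Gordon1999HodgeAVSurvey, Thm. 6.4 and §9.2]
[cite: White1993SporadicCycles, §4 Theorem 3] [cite: Ribet1980, §3 (3.4)] -/
theorem finrank_traceField_eq_or_lt (Φ : CMType K) (hA : IsCMTypeRealisation Φ A ι θ) :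
    (finrank ℚ (traceField Φ) = 2 * (cmTypeRank Φ - 1) ∧
        ∀ m : ℕ, hodgeClassSpan (finrank ℚ K / 2) A.X m = divisorClassesSpan A.X (finrank ℚ K / 2) m) ∨
      (2 * (cmTypeRank Φ - 1) < finrank ℚ (traceField Φ) ∧
        ∃ m : ℕ, ∃ c : complexBetti A.X (2 * m), IsRationalClass c ∧
          IsOfHodgeType (finrank ℚ K / 2) A.X (2 * m) m m c ∧ c ∉ divisorClassesSpan A.X (finrank ℚ K / 2) m) := by
  rcases hodgeClassSpan_eq_or_exists_exceptional Φ hA with ⟨heq, hBD⟩ | ⟨hlt, hex⟩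
  · exact Or.inl ⟨(forall_hodgeClassSpan_eq_iff_finrank_traceField_eq Φ hA).1 hBD, hBD⟩
  · exact Or.inr ⟨(exists_exceptional_iff_lt_finrank_traceField Φ hA).1 hex, hex⟩

/-- **`Bᵐ(A) ⊗ ℂ = Dᵐ(A) ⊗ ℂ` for all `m` iff every odd character of `⟨S(Φ)⟩` is a survivor** (`χ ∈ ⟨S⟩`,
`χ(ρ) = −1 ⟹ Σ_{t ∈ T} χ(t) ≠ 0`): the tree's character criterion (g39-#11: every odd character trivial on
`Stab(T)` survives) read through `Stab(T)^⊥ = ⟨S⟩`. [cite: Kubota1965, §2 and §4 Lemma 2] [cite: Pohlmann1968, Thm. 1]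
[cite: Gordon1999HodgeAVSurvey, Thm. 6.4] [cite: White1993SporadicCycles, §4 Theorem 3] -/
theorem forall_hodgeClassSpan_eq_iff_forall_mem_closure (Φ : CMType K) (φ₀ : K →+* ℂ)
    (hA : IsCMTypeRealisation Φ A ι θ) :
    (∀ m : ℕ, hodgeClassSpan (finrank ℚ K / 2) A.X m = divisorClassesSpan A.X (finrank ℚ K / 2) m) ↔
      ∀ χ ∈ AddSubgroup.closure {χ : AddChar (Additive (K ≃ₐ[ℚ] K)) ℂ |
          χ (Additive.ofMul (conjGal : K ≃ₐ[ℚ] K)) = -1 ∧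
            ∑ s ∈ (Finset.univ.filter fun s : K ≃ₐ[ℚ] K => embOf φ₀ s ∈ Φ.1), χ (Additive.ofMul s) ≠ 0},
        χ (Additive.ofMul (conjGal : K ≃ₐ[ℚ] K)) = -1 →
          ∑ s ∈ (Finset.univ.filter fun s : K ≃ₐ[ℚ] K => embOf φ₀ s ∈ Φ.1), χ (Additive.ofMul s) ≠ 0 := by
  rw [← two_mul_card_stabilizer_mul_eq_iff_forall_hodgeClassSpan_eq Φ φ₀ hA]
  exact two_mul_card_stabilizer_mul_eq_iff_forall_mem_closure (isCMTypeWith_filter_sc Φ φ₀)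

/-- **`A` CARRIES AN EXCEPTIONAL HODGE CLASS IFF SOME ODD CHARACTER OF `⟨S(Φ)⟩` IS ANNIHILATED BY `T`**
(`χ ∈ ⟨S⟩`, `χ(ρ) = −1`, `Σ_{t ∈ T} χ(t) = 0`). [cite: Kubota1965, §2 and §4 Lemma 2] [cite: Pohlmann1968, Thm. 1 and §3]
[cite: White1993SporadicCycles, §4 Theorem 3] [cite: Gordon1999HodgeAVSurvey, Thm. 6.4 and §9.2] -/
theorem exists_exceptional_iff_exists_mem_closure (Φ : CMType K) (φ₀ : K →+* ℂ)
    (hA : IsCMTypeRealisation Φ A ι θ) :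
    (∃ m : ℕ, ∃ c : complexBetti A.X (2 * m), IsRationalClass c ∧
        IsOfHodgeType (finrank ℚ K / 2) A.X (2 * m) m m c ∧ c ∉ divisorClassesSpan A.X (finrank ℚ K / 2) m) ↔
      ∃ χ ∈ AddSubgroup.closure {χ : AddChar (Additive (K ≃ₐ[ℚ] K)) ℂ |
          χ (Additive.ofMul (conjGal : K ≃ₐ[ℚ] K)) = -1 ∧
            ∑ s ∈ (Finset.univ.filter fun s : K ≃ₐ[ℚ] K => embOf φ₀ s ∈ Φ.1), χ (Additive.ofMul s) ≠ 0},
        χ (Additive.ofMul (conjGal : K ≃ₐ[ℚ] K)) = -1 ∧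
          ∑ s ∈ (Finset.univ.filter fun s : K ≃ₐ[ℚ] K => embOf φ₀ s ∈ Φ.1), χ (Additive.ofMul s) = 0 := by
  rw [exists_exceptional_iff_exists_oddCharacter Φ φ₀ hA]
  constructor
  · rintro ⟨χ, hρ, htriv, h0⟩
    exact ⟨χ, (forall_stabilizer_apply_eq_one_iff_mem_closure (isCMTypeWith_filter_sc Φ φ₀) χ).1 htriv, hρ, h0⟩
  · rintro ⟨χ, hχ, hρ, h0⟩
    exact ⟨χ, hρ, (forall_stabilizer_apply_eq_one_iff_mem_closure (isCMTypeWith_filter_sc Φ φ₀) χ).2 hχ, h0⟩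

/-- **An odd number of survivors whose product is annihilated by `T` produces an exceptional Hodge class on `A`.**
[cite: Kubota1965, §4 Lemma 2] [cite: White1993SporadicCycles, §4 Theorem 3] [cite: Gordon1999HodgeAVSurvey, Thm. 6.4 and §9.2] -/
theorem exists_exceptional_of_sum_vanishing (Φ : CMType K) (φ₀ : K →+* ℂ) (hA : IsCMTypeRealisation Φ A ι θ)
    {D : Finset (AddChar (Additive (K ≃ₐ[ℚ] K)) ℂ)}
    (hD : ∀ χ ∈ D, χ (Additive.ofMul (conjGal : K ≃ₐ[ℚ] K)) = -1 ∧
      ∑ s ∈ (Finset.univ.filter fun s : K ≃ₐ[ℚ] K => embOf φ₀ s ∈ Φ.1), χ (Additive.ofMul s) ≠ 0)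
    (hodd : Odd D.card)
    (h0 : ∑ s ∈ (Finset.univ.filter fun s : K ≃ₐ[ℚ] K => embOf φ₀ s ∈ Φ.1), (∑ χ ∈ D, χ) (Additive.ofMul s) = 0) :
    ∃ m : ℕ, ∃ c : complexBetti A.X (2 * m), IsRationalClass c ∧
      IsOfHodgeType (finrank ℚ K / 2) A.X (2 * m) m m c ∧ c ∉ divisorClassesSpan A.X (finrank ℚ K / 2) m :=
  (exists_exceptional_iff_exists_mem_closure Φ φ₀ hA).2
    ((two_mul_card_stabilizer_mul_lt_iff_exists_mem_closure (isCMTypeWith_filter_sc Φ φ₀)).1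
      (two_mul_card_stabilizer_mul_lt_of_sum_vanishing (isCMTypeWith_filter_sc Φ φ₀) hD hodd h0))

/-- **Three survivors `χ₁, χ₂, χ₃` with `Σ_{t ∈ T} (χ₁χ₂χ₃)(t) = 0` produce an exceptional Hodge class on `A`** (for
the majority types of multiquadratic fields `χ₁χ₂χ₃` survives instead and `B = D`). [cite: Kubota1965, §4 Lemma 2]
[cite: White1993SporadicCycles, §4 Theorem 3] [cite: Gordon1999HodgeAVSurvey, Thm. 6.4 and §9.2] -/
theorem exists_exceptional_of_add_add_vanishing (Φ : CMType K) (φ₀ : K →+* ℂ) (hA : IsCMTypeRealisation Φ A ι θ)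
    {χ₁ χ₂ χ₃ : AddChar (Additive (K ≃ₐ[ℚ] K)) ℂ}
    (h₁ : χ₁ (Additive.ofMul (conjGal : K ≃ₐ[ℚ] K)) = -1)
    (hS₁ : ∑ s ∈ (Finset.univ.filter fun s : K ≃ₐ[ℚ] K => embOf φ₀ s ∈ Φ.1), χ₁ (Additive.ofMul s) ≠ 0)
    (h₂ : χ₂ (Additive.ofMul (conjGal : K ≃ₐ[ℚ] K)) = -1)
    (hS₂ : ∑ s ∈ (Finset.univ.filter fun s : K ≃ₐ[ℚ] K => embOf φ₀ s ∈ Φ.1), χ₂ (Additive.ofMul s) ≠ 0)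
    (h₃ : χ₃ (Additive.ofMul (conjGal : K ≃ₐ[ℚ] K)) = -1)
    (hS₃ : ∑ s ∈ (Finset.univ.filter fun s : K ≃ₐ[ℚ] K => embOf φ₀ s ∈ Φ.1), χ₃ (Additive.ofMul s) ≠ 0)
    (h0 : ∑ s ∈ (Finset.univ.filter fun s : K ≃ₐ[ℚ] K => embOf φ₀ s ∈ Φ.1),
      (χ₁ + χ₂ + χ₃) (Additive.ofMul s) = 0) :
    ∃ m : ℕ, ∃ c : complexBetti A.X (2 * m), IsRationalClass c ∧
      IsOfHodgeType (finrank ℚ K / 2) A.X (2 * m) m m c ∧ c ∉ divisorClassesSpan A.X (finrank ℚ K / 2) m :=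
  (exists_exceptional_iff_exists_mem_closure Φ φ₀ hA).2
    ((two_mul_card_stabilizer_mul_lt_iff_exists_mem_closure (isCMTypeWith_filter_sc Φ φ₀)).1
      (two_mul_card_stabilizer_mul_lt_of_add_add_vanishing (isCMTypeWith_filter_sc Φ φ₀) h₁ hS₁ h₂ hS₂ h₃ hS₃ h0))

end Hodge

end Literature.AlgebraicGeometry.Pohlmann1968
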